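import Literature.MathematicalPhysics.QuantumFieldTheory.Balaban1983to89.B1Eq324BenfattoSect5Boxes
import Literature.MathematicalPhysics.QuantumFieldTheory.Balaban1983to89.B1Eq324BenfattoConnLength
import HarnessLib

/-!
# `Balaban1983to89.B1Eq324BenfattoSect5Eq511` — [BenfattoEtAl1978] §5 (5.11) p. 155: «|H^{(l)} Π_Δ χ̂_Δ| ≦ s₁ A b^D e^{−(ϰ/4)b^{3/2}} |I|»
# — the terms of `H_J` reaching across a corridor are exponentially small and extensive — PROVED for the tree's objects

statement-level skeleton of published theorems with citation tags; proofs where landed; nothing here is a claim about the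
Yang–Mills mass gap

WHY THIS MODULE (cell `pub-ymgap`, seat `dag-n08-d` gen 8, INTENT-20; node N08 [Balaban1985UV3]; the [BenfattoEtAl1978] source chain behind
the (α)-row `h324c`: [B10] (24)/(58) ← [B1] (3.24) ← Lemma p. 152 = `B1Eq324BenfattoLemma.BasicLemmaPrinted`).  (5.11) is the FIRST
ESTIMATE of the body of §5's proof of the Basic Lemma (dag-lead DEDUP-295 division: (5.5)–(5.13) + (5.11) this seat; (5.16)–(5.21)/(5.33)
seat n08-b).  Print, p. 155 (render `lit-balaban-typer/renders/benfatto1978-cmp59/bcg_p155_s3.png`, read first-hand): *"H_J = H_{Γ₁} +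
Σ_{□: □∩J≠∅} Ψ_□ + H^{(l)} ≡ Ĥ_J + H^{(l)} (5.9) Ψ_□ = H_{□′∪Γ₂(□)} + H_{Γ₂(□),Γ₁(□)} (5.10) where H^{(l)} = H_J − Ĥ_J can be bounded as
[see (4.5)] |H^{(l)} Π_Δ χ̂_Δ| ≦ s₁Ab^De^{−(ϰ/4)b^{3/2}}|I|. (5.11)"*.

THE ARGUMENT (print gives none beyond «[see (4.5)]»; this is the standard one, typed): in the common indexing by ordered `p`-tuples of
tesserae of `J` (the extension convention «A = 0 if some Δ_i ⊄ J» makes every region Hamiltonian such a sum, `hamiltonian_eq_sum_filter`),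
`Ĥ_J` accounts for three pairwise DISJOINT classes of tuples — inside `Γ₁`; inside some `□′∪Γ₂(□)`; inside some `Γ₂(□)∪Γ₁(□)` meeting both —
so `H^{(l)}` is EXACTLY the sum over the remaining tuples (`Hl_eq_sum_remainder`).  A remaining tuple has a tessera in some `□′∪Γ₂(□)` and
another outside `□`, or one in `□′` and one in `Γ₁(□)`; either way two of its tesserae are `≥ w` apart (a corridor of width `w` lies between), so
`d(Δ) ≥ w` (`le_connLength_of_mem_remainder`, via `B1Eq324BenfattoConnLength.cubeDist_le_connLength`).  Hence `e^{−(ϰ/2)d(Δ)} ≤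
e^{−(ϰ/4)w}·e^{−(ϰ/4)d(Δ)}`; each term is `≤ A·b^D·(that)` on the small-field set (`abs_term_le`); and `Σ_{Δ} e^{−(ϰ/4)d(Δ)}` over ALL `p`-tuples
of `J` is `≤ |J|·K^{p−1}` (`sum_exp_quarter_le`: anchor at `Δ₁`, `d(Δ) ≥` the mean of the `cubeDist(Δ₁, Δ_i)`, and the lattice sum
`B1Eq324BenfattoConnLength.sum_exp_neg_mul_cubeDist_le`).  Summing over `p ≤ s` and the admissible exponents gives (5.11) with
`s₁ = s1Const s D d ϰ = Σ_{p=1}^{s} #admissible(p, D)·K(ϰ, p, d)^{p−1}` — depending on `s, D, d, ϰ` only, as print says.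

WHAT IS HERE (standard axioms; no `sorry`; three small DEFINITIONS of index sets / the summand / the constants, hence definition lane):
`tuplesIn`, `crossTuples`, `hatTuples` (the classes), `term`, `decayConst`, `s1Const`; theorems `hamiltonian_eq_sum_filter`,
`abs_term_le`, `gap_le_cubeDist`, `le_cubeDist_of_mem_shrink_of_not_mem_box`, `le_cubeDist_of_mem_core_of_mem_frame1`, the class algebra
(`mem_tuplesIn`, `tuplesIn_mono`, `tuplesIn_self`, `disjoint_tuplesIn`, `crossTuples_subset`, `exists_mem_of_mem_crossTuples`,
`disjoint_corridorTuples_boxClass`, `pairwiseDisjoint_boxClass`, `disjoint_shrinkTuples_crossTuples`, `sum_crossTuples`,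
★ `sum_univ_eq_hat_add_rem`), ★ `le_connLength_of_mem_remainder`, ★ `sum_exp_neg_mul_connLength_le`, `hamiltonian_eq_sum_tuplesIn`,
`hatH_eq_sum_classes`, ★★ `Hl_eq_sum_remainder`, `sum_exp_quarter_le`, ★★ `abs_Hl_le` = (5.11); v1.1 §6 `hamiltonian_congr_coef`,
`Hl_congr_coef`, ★ `abs_Hl_le_of_range` (the coefficient bound only on the range of (4.5), as print's `A`).
HONEST SCOPE.  The hypotheses are print's: coefficients supported in `J` and bounded by `A`, `|z_Δ| ≤ b` on `J` (print's `Π_Δ χ̂_Δ` with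
`J ⊆ I`, so `d(I, Δ) = 0`), `b ≥ 1`, tesserae of side `L ≥ 1`, corridor width `w` (print: `L = b²`, `w = b^{3/2}`; the typed bound keeps them
free), and `B ⊇` the tesserae meeting `J` (print sums `Ψ_□` over `□ ∩ J ≠ ∅`).  count-neutral for N08; `BasicLemmaPrinted` NOT discharged;
nothing about d = 4, the continuum, OS axioms, a mass gap or the Clay problem.
-/

noncomputable section

open Finset
open scoped BigOperators

namespace Literature.MathematicalPhysics.QuantumFieldTheory.Balaban1983to89.B1Eq324BenfattoSect5Eq511

open Literature.MathematicalPhysics.QuantumFieldTheory.Balaban1983to89.B3Sect3VectorSelfEnergy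
open Literature.MathematicalPhysics.QuantumFieldTheory.Balaban1983to89.B1Eq324BenfattoLemma
open Literature.MathematicalPhysics.QuantumFieldTheory.Balaban1983to89.B1Eq324BenfattoConnLength
open Literature.MathematicalPhysics.QuantumFieldTheory.Balaban1983to89.B1Eq324BenfattoSect5Boxes

variable {d : ℕ}

/-! ## §1  The Hamiltonian of a region as a sum over `J`-tuples (under the extension convention) -/

section TupleSum

variable {s D : ℕ} {κ : ℝ} {a : Coef d} {J : Finset (B1Eq324BenfattoLemma.Site d)}

/-- **`H_R` as a sum over the tuples of `J` lying in `R`**: under print's extension convention («A = 0 if some Δ_i ⊄ J») every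
region Hamiltonian (5.5) is a sum over ONE index type, the ordered `p`-tuples of tesserae of `J`, restricted to those inside `R`.
[cite: BenfattoEtAl1978, (5.5) p.154] -/
theorem hamiltonian_eq_sum_filter (hJ : CoefSupportedIn a J) (R : Finset (B1Eq324BenfattoLemma.Site d))
    (z : B1Eq324BenfattoLemma.Site d → ℝ) :
    hamiltonian s D κ a R z = ∑ p ∈ Finset.Icc 1 s,
      ∑ Δ ∈ (Finset.univ : Finset (Fin p → J)).filter (fun Δ => ∀ i, (Δ i : B1Eq324BenfattoLemma.Site d) ∈ R),
        ∑ n ∈ admissible p D,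
          a p (fun i => (Δ i : B1Eq324BenfattoLemma.Site d)) n *
            Real.exp (-(κ / 2) * connLength fun i => (Δ i : B1Eq324BenfattoLemma.Site d)) * ∏ i, z (Δ i) ^ n i := by
  classical
  unfold hamiltonian
  refine Finset.sum_congr rfl fun p _ => ?_
  -- restrict the sum over `Fin p → R` to the tuples inside `J` (the others have zero coefficient)
  rw [← Finset.sum_subset (Finset.filter_subset
    (fun Δ : Fin p → R => ∀ i, (Δ i : B1Eq324BenfattoLemma.Site d) ∈ J) Finset.univ) ?zero]
  case zero =>
    intro Δ _ hΔ
    have h : ∃ i, (Δ i : B1Eq324BenfattoLemma.Site d) ∉ J := by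
      by_contra hcon
      push Not at hcon
      exact hΔ (Finset.mem_filter.mpr ⟨Finset.mem_univ _, hcon⟩)
    refine Finset.sum_eq_zero fun n _ => ?_
    rw [hJ p _ n h, zero_mul, zero_mul]
  -- a bijection between the two filtered index sets
  refine Finset.sum_bij'
    (fun Δ hΔ => fun k => (⟨(Δ k : B1Eq324BenfattoLemma.Site d), (Finset.mem_filter.mp hΔ).2 k⟩ : J))
    (fun Δ' hΔ' => fun k => (⟨(Δ' k : B1Eq324BenfattoLemma.Site d), (Finset.mem_filter.mp hΔ').2 k⟩ : R))
    ?_ ?_ ?_ ?_ ?_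
  · intro Δ _
    exact Finset.mem_filter.mpr ⟨Finset.mem_univ _, fun k => (Δ k).2⟩
  · intro Δ' _
    exact Finset.mem_filter.mpr ⟨Finset.mem_univ _, fun k => (Δ' k).2⟩
  · intro Δ _
    rfl
  · intro Δ' _
    rfl
  · intro Δ _
    rfl

/-- **The size of one term of (5.5) on the small-field set**: `|A·e^{−(ϰ/2)d(Δ)}·Π z_{Δ_i}^{n_i}| ≤ A·e^{−(ϰ/2)d(Δ)}·b^D` when
`|A^{n}_{Δ}| ≤ A`, `|z_Δ| ≤ b` on the tuple, `b ≥ 1` and `Σ n_i ≤ D` (print: «[see (4.5)]»). [cite: BenfattoEtAl1978, (5.11) p.155] -/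
theorem abs_term_le {p : ℕ} (Δ : Fin p → B1Eq324BenfattoLemma.Site d) (n : Fin p → ℕ) (z : B1Eq324BenfattoLemma.Site d → ℝ)
    {A b : ℝ} (hA : |a p Δ n| ≤ A) (hb : 1 ≤ b) (hz : ∀ i, |z (Δ i)| ≤ b) (hn : ∑ i, n i ≤ D) :
    |a p Δ n * Real.exp (-(κ / 2) * connLength Δ) * ∏ i, z (Δ i) ^ n i| ≤
      A * Real.exp (-(κ / 2) * connLength Δ) * b ^ D := by
  rw [abs_mul, abs_mul, Real.abs_exp, Finset.abs_prod]
  have hprod : ∏ i, |z (Δ i) ^ n i| ≤ b ^ D := by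
    calc ∏ i, |z (Δ i) ^ n i| = ∏ i, |z (Δ i)| ^ n i := Finset.prod_congr rfl fun i _ => abs_pow _ _
      _ ≤ ∏ i, b ^ n i := Finset.prod_le_prod (fun i _ => pow_nonneg (abs_nonneg _) _)
          fun i _ => pow_le_pow_left₀ (abs_nonneg _) (hz i) _
      _ = b ^ ∑ i, n i := (Finset.prod_pow_eq_pow_sum _ _ _)
      _ ≤ b ^ D := pow_le_pow_right₀ hb hn
  have hA0 : 0 ≤ A := (abs_nonneg _).trans hA
  calc |a p Δ n| * Real.exp (-(κ / 2) * connLength Δ) * ∏ i, |z (Δ i) ^ n i|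
      ≤ A * Real.exp (-(κ / 2) * connLength Δ) * b ^ D :=
        mul_le_mul (mul_le_mul_of_nonneg_right hA (Real.exp_pos _).le) hprod
          (Finset.prod_nonneg fun i _ => abs_nonneg _) (mul_nonneg hA0 (Real.exp_pos _).le)

end TupleSum

/-! ## §3  Geometry: tuples reaching across a corridor have `d(Δ) ≥ w` -/

section Geometry

/-- One coordinate gap is at most the cube distance: `max(|x_k − y_k| − 1, 0) ≤ cubeDist x y`.
[cite: BenfattoEtAl1978, after (2.3) p.146] -/
theorem gap_le_cubeDist (x y : B1Eq324BenfattoLemma.Site d) (k : Fin d) :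
    max (|((x k : ℝ) - (y k : ℝ))| - 1) 0 ≤ cubeDist x y := by
  have h0 : 0 ≤ max (|((x k : ℝ) - (y k : ℝ))| - 1) 0 := le_max_right _ _
  rw [cubeDist, ← Real.sqrt_sq h0]
  exact Real.sqrt_le_sqrt (Finset.single_le_sum (f := fun j => max (|((x j : ℝ) - (y j : ℝ))| - 1) 0 ^ 2)
    (fun j _ => sq_nonneg _) (Finset.mem_univ k))

/-- kernel: an integer coordinate difference of at least `w + 1` gives a cube gap of at least `w`. [folklore] -/
private theorem le_cubeDist_of_coord {x y : B1Eq324BenfattoLemma.Site d} {k : Fin d} {w : ℕ}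
    (h : (w : ℤ) + 1 ≤ x k - y k ∨ (w : ℤ) + 1 ≤ y k - x k) : (w : ℝ) ≤ cubeDist x y := by
  refine le_trans ?_ (gap_le_cubeDist x y k)
  refine le_trans ?_ (le_max_left _ _)
  rcases h with h | h
  · have h' : ((w : ℝ) + 1) ≤ (x k : ℝ) - (y k : ℝ) := by exact_mod_cast h
    have := le_abs_self ((x k : ℝ) - (y k : ℝ))
    linarith
  · have h' : ((w : ℝ) + 1) ≤ (y k : ℝ) - (x k : ℝ) := by exact_mod_cast h
    have := neg_abs_le ((x k : ℝ) - (y k : ℝ))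
    have h2 : |(x k : ℝ) - (y k : ℝ)| = |(y k : ℝ) - (x k : ℝ)| := abs_sub_comm _ _
    have := le_abs_self ((y k : ℝ) - (x k : ℝ))
    linarith

/-- **A site of `□′ ∪ Γ₂(□) = shrink w` and a site outside `□` are `≥ w` apart** (the outer corridor `Γ₁(□)` of width `w` separates
them). [cite: BenfattoEtAl1978, (5.7) p.154, (5.11) p.155] -/
theorem le_cubeDist_of_mem_shrink_of_not_mem_box {L w : ℕ} {m x y : B1Eq324BenfattoLemma.Site d}
    (hx : x ∈ shrink L m w) (hy : y ∉ box L m) : (w : ℝ) ≤ cubeDist x y := by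
  rw [mem_shrink_iff] at hx
  rw [mem_box_iff] at hy
  push Not at hy
  obtain ⟨k, hk⟩ := hy
  obtain ⟨hx1, hx2⟩ := hx k
  refine le_cubeDist_of_coord (k := k) ?_
  by_cases h1 : m k * (L : ℤ) ≤ y k
  · have h2 := hk h1
    right; linarith
  · push Not at h1
    left; linarith

/-- **A site of the core `□′ = shrink 2w` and a site of the outer corridor `Γ₁(□)` are `≥ w` apart** (the corridor `Γ₂(□)` of width `w`
separates them). [cite: BenfattoEtAl1978, (5.7) p.154, (5.11) p.155] -/
theorem le_cubeDist_of_mem_core_of_mem_frame1 {L w : ℕ} {m x y : B1Eq324BenfattoLemma.Site d}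
    (hx : x ∈ core L w m) (hy : y ∈ frame1 L w m) : (w : ℝ) ≤ cubeDist x y := by
  rw [core, mem_shrink_iff] at hx
  rw [frame1, Finset.mem_sdiff, mem_box_iff, mem_shrink_iff] at hy
  obtain ⟨hyb, hys⟩ := hy
  push Not at hys
  obtain ⟨k, hk⟩ := hys
  obtain ⟨hx1, hx2⟩ := hx k
  obtain ⟨hy1, hy2⟩ := hyb k
  push_cast at hx1 hx2
  refine le_cubeDist_of_coord (k := k) ?_
  by_cases h1 : m k * (L : ℤ) + w ≤ y k
  · have h2 := hk h1
    right; linarith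
  · push Not at h1
    left; linarith

end Geometry

/-! ## §2  The tuple classes of (5.9): `Ĥ_J` accounts for three disjoint classes, `H^{(l)}` is the sum over the rest -/

section Classes

variable (J : Finset (B1Eq324BenfattoLemma.Site d)) (p : ℕ)

/-- **The ordered `p`-tuples of tesserae of `J` lying inside the region `R`** (the index set of `H_R` in the common indexing of
`hamiltonian_eq_sum_filter`). [cite: BenfattoEtAl1978, (5.5) p.154] -/
def tuplesIn (R : Finset (B1Eq324BenfattoLemma.Site d)) : Finset (Fin p → J) :=
  (Finset.univ : Finset (Fin p → J)).filter fun Δ => ∀ i, (Δ i : B1Eq324BenfattoLemma.Site d) ∈ R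

/-- **The crossing class of a tessera**: the tuples inside `Γ₂(□) ∪ Γ₁(□)` meeting both corridors — the index set of the interaction
`H_{Γ₂(□),Γ₁(□)}` of (5.10). [cite: BenfattoEtAl1978, (5.10) p.155] -/
def crossTuples (L w : ℕ) (m : B1Eq324BenfattoLemma.Site d) : Finset (Fin p → J) :=
  tuplesIn J p (frame2 L w m ∪ frame1 L w m) \ (tuplesIn J p (frame2 L w m) ∪ tuplesIn J p (frame1 L w m))

/-- **The tuples accounted for by `Ĥ_J` (5.9)**: inside `Γ₁`, or inside some `□′ ∪ Γ₂(□)`, or crossing between `Γ₂(□)` and `Γ₁(□)`.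
[cite: BenfattoEtAl1978, (5.9) p.155] -/
def hatTuples (L w : ℕ) (B : Finset (B1Eq324BenfattoLemma.Site d)) : Finset (Fin p → J) :=
  tuplesIn J p (corridors L w B) ∪ B.biUnion fun m => tuplesIn J p (shrink L m w) ∪ crossTuples J p L w m

variable {J p}

/-- Membership in `tuplesIn`. [cite: BenfattoEtAl1978, (5.5) p.154] -/
theorem mem_tuplesIn {R : Finset (B1Eq324BenfattoLemma.Site d)} {Δ : Fin p → J} :
    Δ ∈ tuplesIn J p R ↔ ∀ i, (Δ i : B1Eq324BenfattoLemma.Site d) ∈ R := by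
  simp only [tuplesIn, Finset.mem_filter, Finset.mem_univ, true_and]

/-- `tuplesIn` is monotone in the region. [cite: BenfattoEtAl1978, (5.5) p.154] -/
theorem tuplesIn_mono {R R' : Finset (B1Eq324BenfattoLemma.Site d)} (h : R ⊆ R') : tuplesIn J p R ⊆ tuplesIn J p R' := by
  intro Δ hΔ
  rw [mem_tuplesIn] at hΔ ⊢
  exact fun i => h (hΔ i)

/-- Every `J`-tuple lies in `J`. [cite: BenfattoEtAl1978, (5.5) p.154] -/
theorem tuplesIn_self : tuplesIn J p J = Finset.univ := by
  ext Δ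
  simp only [mem_tuplesIn, Finset.mem_univ, iff_true]
  exact fun i => (Δ i).2

/-- **Disjoint regions have disjoint (non-empty) tuple sets.** [cite: BenfattoEtAl1978, (5.5) p.154] -/
theorem disjoint_tuplesIn {R R' : Finset (B1Eq324BenfattoLemma.Site d)} (h : Disjoint R R') (hp : 0 < p) :
    Disjoint (tuplesIn J p R) (tuplesIn J p R') := by
  rw [Finset.disjoint_left]
  intro Δ h1 h2
  rw [mem_tuplesIn] at h1 h2
  exact Finset.disjoint_left.mp h (h1 ⟨0, hp⟩) (h2 ⟨0, hp⟩)

variable {L w : ℕ} {B : Finset (B1Eq324BenfattoLemma.Site d)}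

/-- The crossing class lies in the tuples of `Γ₂(□) ∪ Γ₁(□)`, hence of `□`. [cite: BenfattoEtAl1978, (5.10) p.155] -/
theorem crossTuples_subset (m : B1Eq324BenfattoLemma.Site d) : crossTuples J p L w m ⊆ tuplesIn J p (box L m) :=
  Finset.sdiff_subset.trans (tuplesIn_mono (Finset.union_subset
    (Finset.sdiff_subset.trans (shrink_subset_box L m w)) Finset.sdiff_subset))

/-- A crossing tuple meets `Γ₂(□)` and meets `Γ₁(□)`. [cite: BenfattoEtAl1978, (5.10) p.155] -/
theorem exists_mem_of_mem_crossTuples {m : B1Eq324BenfattoLemma.Site d} {Δ : Fin p → J} (hΔ : Δ ∈ crossTuples J p L w m) :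
    (∃ i, (Δ i : B1Eq324BenfattoLemma.Site d) ∈ frame2 L w m) ∧ (∃ i, (Δ i : B1Eq324BenfattoLemma.Site d) ∈ frame1 L w m) := by
  rw [crossTuples, Finset.mem_sdiff, Finset.mem_union, mem_tuplesIn, mem_tuplesIn, mem_tuplesIn, not_or] at hΔ
  obtain ⟨hall, h2, h1⟩ := hΔ
  push Not at h2 h1
  obtain ⟨i, hi⟩ := h1
  obtain ⟨j, hj⟩ := h2
  refine ⟨⟨i, ?_⟩, ⟨j, ?_⟩⟩
  · rcases Finset.mem_union.mp (hall i) with h | h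
    · exact h
    · exact absurd h hi
  · rcases Finset.mem_union.mp (hall j) with h | h
    · exact absurd h hj
    · exact h

/-- `Γ₁`-tuples are disjoint from the box classes. [cite: BenfattoEtAl1978, (5.9) p.155] -/
theorem disjoint_corridorTuples_boxClass (hL : 0 < L) (hp : 0 < p) (m : B1Eq324BenfattoLemma.Site d) :
    Disjoint (tuplesIn J p (corridors L w B)) (tuplesIn J p (shrink L m w) ∪ crossTuples J p L w m) := by
  rw [Finset.disjoint_union_right]
  refine ⟨disjoint_tuplesIn (disjoint_corridors_shrink hL w B m) hp, ?_⟩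
  rw [Finset.disjoint_left]
  intro Δ hΓ hC
  obtain ⟨⟨i, hi⟩, -⟩ := exists_mem_of_mem_crossTuples hC
  rw [mem_tuplesIn] at hΓ
  have hi' : (Δ i : B1Eq324BenfattoLemma.Site d) ∈ shrink L m w := Finset.sdiff_subset hi
  exact Finset.disjoint_left.mp (disjoint_corridors_shrink hL w B m) (hΓ i) hi'

/-- The box classes of distinct tesserae are disjoint. [cite: BenfattoEtAl1978, (5.9) p.155] -/
theorem pairwiseDisjoint_boxClass (hL : 0 < L) (hp : 0 < p) :
    (B : Set (B1Eq324BenfattoLemma.Site d)).PairwiseDisjoint fun m => tuplesIn J p (shrink L m w) ∪ crossTuples J p L w m := by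
  intro m _ m' _ hne
  have hsub : ∀ m₀ : B1Eq324BenfattoLemma.Site d,
      tuplesIn J p (shrink L m₀ w) ∪ crossTuples J p L w m₀ ⊆ tuplesIn J p (box L m₀) := fun m₀ =>
    Finset.union_subset (tuplesIn_mono (shrink_subset_box L m₀ w)) (crossTuples_subset m₀)
  exact Finset.disjoint_of_subset_left (hsub m)
    (Finset.disjoint_of_subset_right (hsub m') (disjoint_tuplesIn (disjoint_box hL hne) hp))

/-- Inside one tessera, the `□′∪Γ₂(□)` class and the crossing class are disjoint. [cite: BenfattoEtAl1978, (5.9) p.155] -/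
theorem disjoint_shrinkTuples_crossTuples (m : B1Eq324BenfattoLemma.Site d) :
    Disjoint (tuplesIn J p (shrink L m w)) (crossTuples J p L w m) := by
  rw [Finset.disjoint_left]
  intro Δ hS hC
  obtain ⟨-, ⟨i, hi⟩⟩ := exists_mem_of_mem_crossTuples hC
  rw [mem_tuplesIn] at hS
  exact Finset.disjoint_left.mp (disjoint_frame1_shrink L w m) hi (hS i)

/-- The class sum of the crossing class IS the interaction `H_{Γ₂(□),Γ₁(□)}` in tuple form: `Σ_{cross} = Σ_{Γ₂∪Γ₁} − Σ_{Γ₂} − Σ_{Γ₁}`.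
[cite: BenfattoEtAl1978, (5.6) p.154, (5.10) p.155] -/
theorem sum_crossTuples (hp : 0 < p) (m : B1Eq324BenfattoLemma.Site d) (F : (Fin p → J) → ℝ) :
    ∑ Δ ∈ crossTuples J p L w m, F Δ =
      ∑ Δ ∈ tuplesIn J p (frame2 L w m ∪ frame1 L w m), F Δ -
        ∑ Δ ∈ tuplesIn J p (frame2 L w m), F Δ - ∑ Δ ∈ tuplesIn J p (frame1 L w m), F Δ := by
  have hsub : tuplesIn J p (frame2 L w m) ∪ tuplesIn J p (frame1 L w m) ⊆ tuplesIn J p (frame2 L w m ∪ frame1 L w m) :=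
    Finset.union_subset (tuplesIn_mono Finset.subset_union_left) (tuplesIn_mono Finset.subset_union_right)
  have h := Finset.sum_sdiff (f := F) hsub
  rw [Finset.sum_union (disjoint_tuplesIn (disjoint_frame2_frame1 L w m) hp)] at h
  rw [crossTuples]
  linarith

/-- **THE TUPLE IDENTITY BEHIND (5.9)**: for `p ≥ 1`, summing any weight over all `J`-tuples = over the `Γ₁`-class + over the box classes +
over the REMAINDER `univ ∖ hatTuples`. [cite: BenfattoEtAl1978, (5.9) p.155] -/
theorem sum_univ_eq_hat_add_rem (hL : 0 < L) (hp : 0 < p) (F : (Fin p → J) → ℝ) :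
    ∑ Δ, F Δ = ∑ Δ ∈ tuplesIn J p (corridors L w B), F Δ
      + ∑ m ∈ B, (∑ Δ ∈ tuplesIn J p (shrink L m w), F Δ + ∑ Δ ∈ crossTuples J p L w m, F Δ)
      + ∑ Δ ∈ Finset.univ \ hatTuples J p L w B, F Δ := by
  classical
  have h1 := Finset.sum_sdiff (f := F) (Finset.subset_univ (hatTuples J p L w B))
  have h2 : ∑ Δ ∈ hatTuples J p L w B, F Δ = ∑ Δ ∈ tuplesIn J p (corridors L w B), F Δ
      + ∑ m ∈ B, (∑ Δ ∈ tuplesIn J p (shrink L m w), F Δ + ∑ Δ ∈ crossTuples J p L w m, F Δ) := by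
    rw [hatTuples, Finset.sum_union, Finset.sum_biUnion (pairwiseDisjoint_boxClass hL hp)]
    · congr 1
      refine Finset.sum_congr rfl fun m _ => ?_
      rw [Finset.sum_union (disjoint_shrinkTuples_crossTuples m)]
    · rw [Finset.disjoint_biUnion_right]
      exact fun m _ => disjoint_corridorTuples_boxClass hL hp m
  linarith

end Classes

/-! ## §3′  Every remainder tuple reaches across a corridor -/

section Remainder

variable {J : Finset (B1Eq324BenfattoLemma.Site d)} {p L w : ℕ} {B : Finset (B1Eq324BenfattoLemma.Site d)}

/-- **EVERY TUPLE OF `H^{(l)}` REACHES ACROSS A CORRIDOR: `d(Δ) ≥ w`** for `Δ` in the remainder `univ ∖ hatTuples` (with `B ⊇` the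
tesserae meeting `J`, `L ≥ 1`): such a tuple has a tessera in some `□′∪Γ₂(□)` (it is not inside `Γ₁`) and another one outside `□`
(distance `≥ w` across `Γ₁(□)`), or one in the core `□′` and one in `Γ₁(□)` (distance `≥ w` across `Γ₂(□)`) — the geometric half of
(5.11)'s «e^{−(ϰ/4)b^{3/2}}». [cite: BenfattoEtAl1978, (5.11) p.155] -/
theorem le_connLength_of_mem_remainder (hL : 0 < L) (hB : J.image (boxIndex L) ⊆ B) {Δ : Fin p → J}
    (hΔ : Δ ∈ Finset.univ \ hatTuples J p L w B) :
    (w : ℝ) ≤ connLength fun i => (Δ i : B1Eq324BenfattoLemma.Site d) := by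
  classical
  rw [Finset.mem_sdiff, hatTuples, Finset.mem_union, not_or, Finset.mem_biUnion, not_exists] at hΔ
  obtain ⟨-, hΓ, hbox⟩ := hΔ
  -- a tessera of the tuple outside Γ₁: it lies in the shrunk part of its own box `m ∈ B`
  rw [mem_tuplesIn] at hΓ
  push Not at hΓ
  obtain ⟨i, hi⟩ := hΓ
  set m : B1Eq324BenfattoLemma.Site d := boxIndex L (Δ i : B1Eq324BenfattoLemma.Site d) with hm
  have hmB : m ∈ B := hB (Finset.mem_image_of_mem _ (Δ i).2)
  have hxbox : (Δ i : B1Eq324BenfattoLemma.Site d) ∈ box L m := mem_box_boxIndex hL _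
  have hxS : (Δ i : B1Eq324BenfattoLemma.Site d) ∈ shrink L m w := by
    by_contra hxS
    exact hi (frame1_subset_corridors L w hmB (Finset.mem_sdiff.mpr ⟨hxbox, hxS⟩))
  -- the tuple is not in the classes of the box `m`
  have hm' := hbox m
  rw [not_and] at hm'
  have hnot := hm' hmB
  rw [Finset.mem_union, not_or, mem_tuplesIn] at hnot
  obtain ⟨hS, hC⟩ := hnot
  push Not at hS
  obtain ⟨j, hj⟩ := hS
  -- case 1: `Δ j` outside the box
  by_cases hjbox : (Δ j : B1Eq324BenfattoLemma.Site d) ∈ box L m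
  swap
  · exact (le_cubeDist_of_mem_shrink_of_not_mem_box hxS hjbox).trans (cubeDist_le_connLength (fun k => (Δ k : B1Eq324BenfattoLemma.Site d)) i j)
  -- `Δ j ∈ Γ₁(□)`
  have hjF1 : (Δ j : B1Eq324BenfattoLemma.Site d) ∈ frame1 L w m := Finset.mem_sdiff.mpr ⟨hjbox, hj⟩
  -- case 2: some tessera outside `Γ₂(□) ∪ Γ₁(□)`
  by_cases hall : ∀ k, (Δ k : B1Eq324BenfattoLemma.Site d) ∈ frame2 L w m ∪ frame1 L w m
  · -- impossible: then `Δ` would be a crossing tuple (it is in neither `Γ₂`-only nor `Γ₁`-only)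
    exfalso
    refine hC (Finset.mem_sdiff.mpr ⟨mem_tuplesIn.mpr hall, ?_⟩)
    rw [Finset.mem_union, not_or, mem_tuplesIn, mem_tuplesIn]
    refine ⟨fun h2 => hj (Finset.sdiff_subset (h2 j)), fun h1 => ?_⟩
    exact Finset.disjoint_left.mp (disjoint_frame1_shrink L w m) (h1 i) hxS
  · push Not at hall
    obtain ⟨k, hk⟩ := hall
    rw [Finset.mem_union, not_or] at hk
    by_cases hkbox : (Δ k : B1Eq324BenfattoLemma.Site d) ∈ box L m
    · -- `Δ k ∈ □′`: distance `≥ w` to `Δ j ∈ Γ₁(□)`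
      have hkS : (Δ k : B1Eq324BenfattoLemma.Site d) ∈ shrink L m w := by
        by_contra h
        exact hk.2 (Finset.mem_sdiff.mpr ⟨hkbox, h⟩)
      have hkcore : (Δ k : B1Eq324BenfattoLemma.Site d) ∈ core L w m := by
        by_contra h
        exact hk.1 (Finset.mem_sdiff.mpr ⟨hkS, h⟩)
      exact (le_cubeDist_of_mem_core_of_mem_frame1 hkcore hjF1).trans (cubeDist_le_connLength (fun k => (Δ k : B1Eq324BenfattoLemma.Site d)) k j)
    · exact (le_cubeDist_of_mem_shrink_of_not_mem_box hxS hkbox).trans (cubeDist_le_connLength (fun k => (Δ k : B1Eq324BenfattoLemma.Site d)) i k)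

end Remainder

/-! ## §4  Counting: `Σ_{Δ} e^{−c·d(Δ)}` over the `p`-tuples of `J` is `O(|J|)` -/

section Counting

variable {J : Finset (B1Eq324BenfattoLemma.Site d)}

/-- **Summing the decay factor over all `p`-tuples of `J` costs a constant per anchor tessera**: for `c > 0` and `p ≥ 1`,
`Σ_{Δ : Fin p → J} e^{−c·d(Δ)} ≤ |J| · K(c/p, d)^{p−1}` with `K` the lattice-sum constant of
`B1Eq324BenfattoConnLength.sum_exp_neg_mul_cubeDist_le` (anchor at `Δ 0`; the other `p − 1` tesserae are summed freely) — the
«|I|» of (5.11). [cite: BenfattoEtAl1978, (5.11) p.155] -/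
theorem sum_exp_neg_mul_connLength_le {c : ℝ} (hc : 0 < c) (p : ℕ) :
    ∑ Δ : Fin (p + 1) → J, Real.exp (-(c * connLength fun i => (Δ i : B1Eq324BenfattoLemma.Site d))) ≤
      J.card * ((2 / (1 - Real.exp (-(c / (p + 1 : ℕ) / Real.sqrt d))) * Real.exp (c / (p + 1 : ℕ) / Real.sqrt d)) ^ d) ^ p := by
  classical
  set c' : ℝ := c / (p + 1 : ℕ) with hc'
  set K : ℝ := (2 / (1 - Real.exp (-(c' / Real.sqrt d))) * Real.exp (c' / Real.sqrt d)) ^ d with hK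
  have hc'0 : 0 < c' := div_pos hc (by exact_mod_cast Nat.succ_pos p)
  set g : B1Eq324BenfattoLemma.Site d → B1Eq324BenfattoLemma.Site d → ℝ := fun x y => Real.exp (-(c' * cubeDist x y)) with hg
  -- step 1: anchor at `Δ 0`
  have h1 : ∀ Δ : Fin (p + 1) → J, Real.exp (-(c * connLength fun i => (Δ i : B1Eq324BenfattoLemma.Site d)))
      ≤ ∏ i : Fin (p + 1), g (Δ 0) (Δ i) := by
    intro Δ
    have h := exp_neg_mul_connLength_le_prod (fun i => (Δ i : B1Eq324BenfattoLemma.Site d)) 0 hc.le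
    simpa only [hg, hc', Nat.cast_add, Nat.cast_one] using h
  -- step 2: split off the anchor coordinate and factor the rest
  have hgxx : ∀ x : J, g x x = 1 := by
    intro x
    have hz : ∀ j : Fin d, max (|(((x : B1Eq324BenfattoLemma.Site d) j : ℤ) : ℝ) - (((x : B1Eq324BenfattoLemma.Site d) j : ℤ) : ℝ)| - 1) 0 ^ 2
        = 0 := by
      intro j
      rw [sub_self, abs_zero, zero_sub, max_eq_right (by norm_num : (-1 : ℝ) ≤ 0)]
      ring
    simp only [hg, cubeDist, hz, Finset.sum_const_zero, Real.sqrt_zero, mul_zero, neg_zero, Real.exp_zero]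
  have h2 : ∑ Δ : Fin (p + 1) → J, ∏ i : Fin (p + 1), g (Δ 0) (Δ i)
      = ∑ x : J, ∏ _i : Fin p, ∑ y : J, g x y := by
    rw [Fintype.sum_equiv (Fin.consEquiv fun _ : Fin (p + 1) => (J : Type _)).symm
      (fun Δ : Fin (p + 1) → J => ∏ i : Fin (p + 1), g (Δ 0) (Δ i))
      (fun q : J × (Fin p → J) => ∏ i : Fin p, g q.1 (q.2 i)) ?_]
    · rw [Fintype.sum_prod_type]
      refine Finset.sum_congr rfl fun x _ => ?_
      rw [Finset.prod_univ_sum (fun _ : Fin p => (Finset.univ : Finset J)) (fun _ y => g x y), Fintype.piFinset_univ]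
    · intro Δ
      show ∏ i : Fin (p + 1), g (Δ 0) (Δ i) = ∏ i : Fin p, g (Δ 0) (Fin.tail Δ i)
      rw [Fin.prod_univ_succ, hgxx, one_mul]
      rfl
  -- step 3: the inner lattice sum is ≤ K
  have h3 : ∀ x : J, ∑ y : J, g x y ≤ K := by
    intro x
    rw [Finset.sum_coe_sort (s := J) (f := fun y => g x y)]
    exact sum_exp_neg_mul_cubeDist_le hc'0 J x
  have hg0 : ∀ x y : B1Eq324BenfattoLemma.Site d, 0 ≤ g x y := fun x y => (Real.exp_pos _).le
  calc ∑ Δ : Fin (p + 1) → J, Real.exp (-(c * connLength fun i => (Δ i : B1Eq324BenfattoLemma.Site d)))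
      ≤ ∑ Δ : Fin (p + 1) → J, ∏ i : Fin (p + 1), g (Δ 0) (Δ i) := Finset.sum_le_sum fun Δ _ => h1 Δ
    _ = ∑ x : J, ∏ _i : Fin p, ∑ y : J, g x y := h2
    _ ≤ ∑ _x : J, K ^ p := by
        refine Finset.sum_le_sum fun x _ => ?_
        rw [Finset.prod_const, Finset.card_univ, Fintype.card_fin]
        exact pow_le_pow_left₀ (Finset.sum_nonneg fun y _ => hg0 _ _) (h3 x) p
    _ = J.card * K ^ p := by
        rw [Finset.sum_const, Finset.card_univ, Fintype.card_coe, nsmul_eq_mul]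

end Counting

/-! ## §5  (5.11): `H^{(l)}` is the sum over the remainder tuples, and its bound -/

section Main

variable {s D : ℕ} {κ : ℝ} {a : Coef d} {J : Finset (B1Eq324BenfattoLemma.Site d)} {L w : ℕ}
  {B : Finset (B1Eq324BenfattoLemma.Site d)}

/-- **The summand of (5.5) in the common indexing** (`J`-tuples): `A^{n}_{Δ}·e^{−(ϰ/2)d(Δ)}·Π_i z_{Δ_i}^{n_i}`.
[cite: BenfattoEtAl1978, (5.5) p.154] -/
def term (κ : ℝ) (a : Coef d) (z : B1Eq324BenfattoLemma.Site d → ℝ) (p : ℕ) (Δ : Fin p → J) (n : Fin p → ℕ) : ℝ :=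
  a p (fun i => (Δ i : B1Eq324BenfattoLemma.Site d)) n *
    Real.exp (-(κ / 2) * connLength fun i => (Δ i : B1Eq324BenfattoLemma.Site d)) * ∏ i, z (Δ i) ^ n i

/-- `H_R` in the common indexing, with `tuplesIn`. [cite: BenfattoEtAl1978, (5.5) p.154] -/
theorem hamiltonian_eq_sum_tuplesIn (hJ : CoefSupportedIn a J) (R : Finset (B1Eq324BenfattoLemma.Site d))
    (z : B1Eq324BenfattoLemma.Site d → ℝ) :
    hamiltonian s D κ a R z = ∑ p ∈ Finset.Icc 1 s, ∑ Δ ∈ tuplesIn J p R, ∑ n ∈ admissible p D, term κ a z p Δ n :=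
  hamiltonian_eq_sum_filter hJ R z

/-- **`Ĥ_J` (5.9) in tuple form**: the `Γ₁`-class plus, per tessera, the `□′∪Γ₂(□)`-class and the crossing class.
[cite: BenfattoEtAl1978, (5.9) p.155] -/
theorem hatH_eq_sum_classes (hJ : CoefSupportedIn a J) (z : B1Eq324BenfattoLemma.Site d → ℝ) :
    hatH s D κ a L w B z = ∑ p ∈ Finset.Icc 1 s,
      (∑ Δ ∈ tuplesIn J p (corridors L w B), ∑ n ∈ admissible p D, term κ a z p Δ n
        + ∑ m ∈ B, (∑ Δ ∈ tuplesIn J p (shrink L m w), ∑ n ∈ admissible p D, term κ a z p Δ n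
          + ∑ Δ ∈ crossTuples J p L w m, ∑ n ∈ admissible p D, term κ a z p Δ n)) := by
  rw [hatH, Finset.sum_add_distrib, hamiltonian_eq_sum_tuplesIn hJ]
  congr 1
  rw [Finset.sum_comm]
  refine Finset.sum_congr rfl fun m _ => ?_
  simp only [psiBox, interaction, hamiltonian_eq_sum_tuplesIn hJ]
  rw [← Finset.sum_sub_distrib, ← Finset.sum_sub_distrib, ← Finset.sum_add_distrib]
  refine Finset.sum_congr rfl fun p hp => ?_
  have hp1 : 0 < p := (Finset.mem_Icc.mp hp).1
  rw [sum_crossTuples hp1 m]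

/-- **`H^{(l)} = H_J − Ĥ_J` IS THE SUM OVER THE REMAINDER TUPLES** (those in none of the three classes of (5.9)).
[cite: BenfattoEtAl1978, (5.9) p.155] -/
theorem Hl_eq_sum_remainder (hJ : CoefSupportedIn a J) (hL : 0 < L) (z : B1Eq324BenfattoLemma.Site d → ℝ) :
    Hl s D κ a J L w B z = ∑ p ∈ Finset.Icc 1 s,
      ∑ Δ ∈ Finset.univ \ hatTuples J p L w B, ∑ n ∈ admissible p D, term κ a z p Δ n := by
  classical
  rw [Hl, hatH_eq_sum_classes hJ, hamiltonian_eq_sum_tuplesIn hJ, ← Finset.sum_sub_distrib]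
  refine Finset.sum_congr rfl fun p hp => ?_
  have hp1 : 0 < p := (Finset.mem_Icc.mp hp).1
  rw [tuplesIn_self, sum_univ_eq_hat_add_rem (w := w) (B := B) hL hp1 (fun Δ => ∑ n ∈ admissible p D, term κ a z p Δ n)]
  ring

/-- **The constant of the lattice sum at decay rate `ϰ/4` spread over `p` tesserae** (depends on `ϰ`, `p`, `d` only).
[cite: BenfattoEtAl1978, (5.11) p.155] -/
def decayConst (κ : ℝ) (p d : ℕ) : ℝ :=
  (2 / (1 - Real.exp (-(κ / 4 / p / Real.sqrt d))) * Real.exp (κ / 4 / p / Real.sqrt d)) ^ d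

/-- **`s₁` of (5.11)**: `Σ_{p=1}^{s} #{admissible exponents} · K(ϰ, p, d)^{p−1}` — depends on `s, D, d, ϰ` only, as print says.
[cite: BenfattoEtAl1978, (5.11) p.155] -/
def s1Const (s D d : ℕ) (κ : ℝ) : ℝ :=
  ∑ p ∈ Finset.Icc 1 s, ((admissible p D).card : ℝ) * decayConst κ p d ^ (p - 1)

/-- The remainder sum of the decay factor at rate `ϰ/4` is `O(|J|)` (`p ≥ 1`). [cite: BenfattoEtAl1978, (5.11) p.155] -/
theorem sum_exp_quarter_le (hκ : 0 < κ) {p : ℕ} (hp : 0 < p) :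
    ∑ Δ : Fin p → J, Real.exp (-(κ / 4 * connLength fun i => (Δ i : B1Eq324BenfattoLemma.Site d))) ≤
      J.card * decayConst κ p d ^ (p - 1) := by
  obtain ⟨p', rfl⟩ := Nat.exists_eq_succ_of_ne_zero hp.ne'
  have h := sum_exp_neg_mul_connLength_le (J := J) (d := d) (c := κ / 4) (by positivity) p'
  simp only [Nat.succ_sub_one, decayConst]
  convert h using 4

/-- **(5.11) — THE CROSS-CORRIDOR PART OF `H_J` IS EXPONENTIALLY SMALL AND EXTENSIVE**: p. 155, *"H^{(l)} = H_J − Ĥ_J can be bounded as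
[see (4.5)] |H^{(l)} Π_Δ χ̂_Δ| ≦ s₁Ab^De^{−(ϰ/4)b^{3/2}}|I|"*.  PROVED for the tree's objects: under the extension convention
`CoefSupportedIn a J`, with `|A^{n}_{Δ}| ≤ A`, on configurations with `|z_Δ| ≤ b` for `Δ ⊂ J` (print's `Π_Δ χ̂_Δ` with `J ⊆ I`), `b ≥ 1`,
tesserae of side `L ≥ 1`, corridors of width `w`, and `B ⊇` the tesserae meeting `J`:
`|H^{(l)}(z)| ≤ s₁ · A · b^D · e^{−(ϰ/4)w} · |J|`, `s₁ = s1Const s D d ϰ` (print: `w = b^{3/2}`, `|J| ≤ |I|`).  Every remainder tuple has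
`d(Δ) ≥ w` (`le_connLength_of_mem_remainder`), so `e^{−(ϰ/2)d} ≤ e^{−(ϰ/4)w}e^{−(ϰ/4)d}`, and the remaining `e^{−(ϰ/4)d}` is summable
over all tuples with an `O(|J|)` total (`sum_exp_quarter_le`). [cite: BenfattoEtAl1978, (5.11) p.155] -/
theorem abs_Hl_le (hκ : 0 < κ) (hJ : CoefSupportedIn a J) {A : ℝ}
    (hA : ∀ (p : ℕ) (Δ : Fin p → B1Eq324BenfattoLemma.Site d) (n : Fin p → ℕ), |a p Δ n| ≤ A)
    (hL : 0 < L) (hB : J.image (boxIndex L) ⊆ B) {z : B1Eq324BenfattoLemma.Site d → ℝ} {b : ℝ} (hb : 1 ≤ b)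
    (hz : ∀ x ∈ J, |z x| ≤ b) :
    |Hl s D κ a J L w B z| ≤ s1Const s D d κ * A * b ^ D * Real.exp (-(κ / 4 * w)) * J.card := by
  classical
  rw [Hl_eq_sum_remainder hJ hL]
  have hA0 : 0 ≤ A := (abs_nonneg _).trans (hA 0 Fin.elim0 Fin.elim0)
  -- per tuple of the remainder: the bound with the split exponential
  have hterm : ∀ {p : ℕ} (Δ : Fin p → J), Δ ∈ Finset.univ \ hatTuples J p L w B → ∀ n ∈ admissible p D,
      |term κ a z p Δ n| ≤ A * b ^ D * Real.exp (-(κ / 4 * w)) *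
        Real.exp (-(κ / 4 * connLength fun i => (Δ i : B1Eq324BenfattoLemma.Site d))) := by
    intro p Δ hΔ n hn
    have h1 := abs_term_le (κ := κ) (D := D) (fun i => (Δ i : B1Eq324BenfattoLemma.Site d)) n z (hA p _ n) hb
      (fun i => hz _ (Δ i).2) (mem_admissible.mp hn).2
    have hd := le_connLength_of_mem_remainder (w := w) hL hB hΔ
    have hsplit : Real.exp (-(κ / 2) * connLength fun i => (Δ i : B1Eq324BenfattoLemma.Site d)) ≤
        Real.exp (-(κ / 4 * w)) * Real.exp (-(κ / 4 * connLength fun i => (Δ i : B1Eq324BenfattoLemma.Site d))) := by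
      rw [← Real.exp_add, Real.exp_le_exp]
      nlinarith
    calc |term κ a z p Δ n| ≤ A * Real.exp (-(κ / 2) * connLength fun i => (Δ i : B1Eq324BenfattoLemma.Site d)) * b ^ D := h1
      _ ≤ A * (Real.exp (-(κ / 4 * w)) * Real.exp (-(κ / 4 * connLength fun i => (Δ i : B1Eq324BenfattoLemma.Site d)))) * b ^ D :=
          mul_le_mul_of_nonneg_right (mul_le_mul_of_nonneg_left hsplit hA0) (pow_nonneg (by linarith) D)
      _ = _ := by ring
  -- sum it up
  calc |∑ p ∈ Finset.Icc 1 s, ∑ Δ ∈ Finset.univ \ hatTuples J p L w B, ∑ n ∈ admissible p D, term κ a z p Δ n|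
      ≤ ∑ p ∈ Finset.Icc 1 s, ∑ Δ ∈ Finset.univ \ hatTuples J p L w B, ∑ n ∈ admissible p D, |term κ a z p Δ n| := by
        refine (Finset.abs_sum_le_sum_abs _ _).trans (Finset.sum_le_sum fun p _ => ?_)
        refine (Finset.abs_sum_le_sum_abs _ _).trans (Finset.sum_le_sum fun Δ _ => ?_)
        exact Finset.abs_sum_le_sum_abs _ _
    _ ≤ ∑ p ∈ Finset.Icc 1 s, ∑ Δ ∈ Finset.univ \ hatTuples J p L w B, ∑ _n ∈ admissible p D,
          A * b ^ D * Real.exp (-(κ / 4 * w)) * Real.exp (-(κ / 4 * connLength fun i => (Δ i : B1Eq324BenfattoLemma.Site d))) :=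
        Finset.sum_le_sum fun p _ => Finset.sum_le_sum fun Δ hΔ => Finset.sum_le_sum fun n hn => hterm Δ hΔ n hn
    _ = ∑ p ∈ Finset.Icc 1 s, A * b ^ D * Real.exp (-(κ / 4 * w)) * ((admissible p D).card *
          ∑ Δ ∈ Finset.univ \ hatTuples J p L w B, Real.exp (-(κ / 4 * connLength fun i => (Δ i : B1Eq324BenfattoLemma.Site d)))) := by
        refine Finset.sum_congr rfl fun p _ => ?_
        simp only [Finset.sum_const, nsmul_eq_mul]
        rw [Finset.mul_sum, Finset.mul_sum]
        refine Finset.sum_congr rfl fun Δ _ => ?_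
        ring
    _ ≤ ∑ p ∈ Finset.Icc 1 s, A * b ^ D * Real.exp (-(κ / 4 * w)) * ((admissible p D).card *
          (J.card * decayConst κ p d ^ (p - 1))) := by
        refine Finset.sum_le_sum fun p hp => ?_
        have hp1 : 0 < p := (Finset.mem_Icc.mp hp).1
        refine mul_le_mul_of_nonneg_left (mul_le_mul_of_nonneg_left ?_ (Nat.cast_nonneg _)) (by positivity)
        calc ∑ Δ ∈ Finset.univ \ hatTuples J p L w B, Real.exp (-(κ / 4 * connLength fun i => (Δ i : B1Eq324BenfattoLemma.Site d)))
            ≤ ∑ Δ : Fin p → J, Real.exp (-(κ / 4 * connLength fun i => (Δ i : B1Eq324BenfattoLemma.Site d))) :=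
              Finset.sum_le_sum_of_subset_of_nonneg (Finset.subset_univ _) fun Δ _ _ => (Real.exp_pos _).le
          _ ≤ J.card * decayConst κ p d ^ (p - 1) := sum_exp_quarter_le hκ hp1
    _ = s1Const s D d κ * A * b ^ D * Real.exp (-(κ / 4 * w)) * J.card := by
        rw [s1Const, Finset.sum_mul, Finset.sum_mul, Finset.sum_mul, Finset.sum_mul]
        refine Finset.sum_congr rfl fun p _ => ?_
        ring

end Main

/-! ## §6  (5.11) with the coefficient bound only on the range of (4.5) (v1.1; ref-G READ175 NIT-1) -/

section Range

variable {s D : ℕ} {κ : ℝ} {a a' : Coef d} {J : Finset (B1Eq324BenfattoLemma.Site d)} {L w : ℕ}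
  {B : Finset (B1Eq324BenfattoLemma.Site d)}

/-- Two coefficient families agreeing on the index range of (4.5)/(5.5) (`1 ≤ p ≤ s`, `n` admissible) give the same `H_R`.
[cite: BenfattoEtAl1978, (4.5) p.152, (5.5) p.154] -/
theorem hamiltonian_congr_coef (R : Finset (B1Eq324BenfattoLemma.Site d)) (z : B1Eq324BenfattoLemma.Site d → ℝ)
    (h : ∀ p ∈ Finset.Icc 1 s, ∀ (Δ : Fin p → B1Eq324BenfattoLemma.Site d), ∀ n ∈ admissible p D, a p Δ n = a' p Δ n) :
    hamiltonian s D κ a R z = hamiltonian s D κ a' R z := by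
  unfold hamiltonian
  refine Finset.sum_congr rfl fun p hp => Finset.sum_congr rfl fun Δ _ => Finset.sum_congr rfl fun n hn => ?_
  rw [h p hp _ n hn]

/-- … hence the same `H^{(l)}`. [cite: BenfattoEtAl1978, (5.9) p.155] -/
theorem Hl_congr_coef (z : B1Eq324BenfattoLemma.Site d → ℝ)
    (h : ∀ p ∈ Finset.Icc 1 s, ∀ (Δ : Fin p → B1Eq324BenfattoLemma.Site d), ∀ n ∈ admissible p D, a p Δ n = a' p Δ n) :
    Hl s D κ a J L w B z = Hl s D κ a' J L w B z := by
  simp only [Hl, hatH, psiBox, interaction, hamiltonian_congr_coef _ z h]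

/-- **(5.11) with print's `A ≡ sup |A^{n}_{Δ}|` over the RANGE of (4.5) only** (ref-G READ175 NIT-1): the coefficient bound is needed only for
`1 ≤ p ≤ s`, tuples inside `J` and admissible exponents (for the tree's `coefSup`, that bound is `B1Eq324BenfattoSpecialisation.abs_coef_le_coefSup`);
reduction to `abs_Hl_le` through the truncated family `a′ = a·1_{range}` (same `H^{(l)}` by the extension convention).
[cite: BenfattoEtAl1978, (5.11) p.155] -/
theorem abs_Hl_le_of_range (hκ : 0 < κ) (hJ : CoefSupportedIn a J) {A : ℝ} (hA0 : 0 ≤ A)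
    (hA : ∀ p ∈ Finset.Icc 1 s, ∀ (Δ : Fin p → B1Eq324BenfattoLemma.Site d), (∀ i, Δ i ∈ J) →
      ∀ n ∈ admissible p D, |a p Δ n| ≤ A)
    (hL : 0 < L) (hB : J.image (boxIndex L) ⊆ B) {z : B1Eq324BenfattoLemma.Site d → ℝ} {b : ℝ} (hb : 1 ≤ b)
    (hz : ∀ x ∈ J, |z x| ≤ b) :
    |Hl s D κ a J L w B z| ≤ s1Const s D d κ * A * b ^ D * Real.exp (-(κ / 4 * w)) * J.card := by
  classical
  -- the truncated coefficient family
  let a' : Coef d := fun p Δ n =>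
    if p ∈ Finset.Icc 1 s ∧ (∀ i, Δ i ∈ J) ∧ n ∈ admissible p D then a p Δ n else 0
  have hagree : ∀ p ∈ Finset.Icc 1 s, ∀ (Δ : Fin p → B1Eq324BenfattoLemma.Site d), ∀ n ∈ admissible p D, a p Δ n = a' p Δ n := by
    intro p hp Δ n hn
    by_cases hΔ : ∀ i, Δ i ∈ J
    · simp only [a']
      rw [if_pos ⟨hp, hΔ, hn⟩]
    · push Not at hΔ
      have h0 : a p Δ n = 0 := hJ p Δ n hΔ
      simp only [a', h0]
      split_ifs <;> rfl
  have hJ' : CoefSupportedIn a' J := by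
    intro p Δ n hΔ
    obtain ⟨i, hi⟩ := hΔ
    simp only [a']
    rw [if_neg]
    exact fun h => hi (h.2.1 i)
  have hA' : ∀ (p : ℕ) (Δ : Fin p → B1Eq324BenfattoLemma.Site d) (n : Fin p → ℕ), |a' p Δ n| ≤ A := by
    intro p Δ n
    simp only [a']
    split_ifs with h
    · exact hA p h.1 Δ h.2.1 n h.2.2
    · rw [abs_zero]
      exact hA0
  rw [Hl_congr_coef z hagree]
  exact abs_Hl_le hκ hJ' hA' hL hB hb hz

end Range

end Literature.MathematicalPhysics.QuantumFieldTheory.Balaban1983to89.B1Eq324BenfattoSect5Eq511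

end
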